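import Summits.BirchSwinnertonDyer.Rank1Residual.P2.CongruentNumberTwoPrimeThreeModEightMonskyDescent
import Literature.NumberTheory.EllipticCurves.Tian2014.CMPointSystemDescentPrimeSeven
import HarnessLib

/-!
# Cell «bsd-monsky» (prover-A, g13): ROUTE A AT ONE PRIME, the other half — `N = 2p`, `p ≡ 7 (mod 8)` (Monsky's `2p₇`,
# Cor. 5.15 (1)), from Tian's printed CM-point system plus two printed sentences: Tian Prop. 4.6 = Monsky Thm. 4.9 for
# Tian's point `2y_{2p}`; rank `E_{2p}(ℚ) = 1`, `2p` congruent, `Ш(E_{2p})[2^∞] = 0`, odd index — and the EVEN TWIST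
# of Prop. 4.6 for ALL primes `p ≡ 3 (mod 4)`

HONEST FRAMING (cell `bsd-monsky`, run/shared/lean/pub/bsd-monsky/, README §1: ONE theorem on ONE explicit infinite
family at the prime `2`; nothing booked). This file asserts NO arithmetic fact and claims NOTHING new on paper: that
`2p` is a congruent number for every prime `p ≡ 7 (mod 8)` is classical (Monsky 1990 Thm. 4.9 / Cor. 5.15 (1) «`2p₇`»;
Tian 2014 Prop. 4.6 «proved in [19]»). The sibling `CongruentNumberTwoPrimeThreeModEightMonskyDescent` did `p ≡ 3 (8)`
from the binder `{D.Printed, «σ_{1+ϖ} fixes √2»}`; the `p ≡ 7 (8)` case needs ONE more printed sentence — «`σ_t` fixes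
`√−2p₀` but moves `√2`» for `[t] ∈ 𝒜 − 2𝒜` (p0024 L26; Tian's Notations (ii) «`2𝒜 ≃ Gal(H/H₀)`», `√2 ∈ H₀ = K(√−p₀)`) — and
the consequences are recorded from the PRINTED SYSTEM BINDER
`hSk₇ : ∀ p ≡ 7 (8) prime, ∃ D : CMPointData p, D.Printed ∧ (∀ s, s² = 2 → σ_{1+ϖ}(s) = s) ∧ (∀ t ∉ 2𝒜, ∀ s, s² = 2 → σ_t(s) = −s)`
alone (binder form, no new named fact; no Gross–Zagier display, no `2`-Selmer display; `𝒜[2] = {1, [ϖ′]}` is Gauss, a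
tree theorem; the transversal `⋃_{i<m} [t]^i φ₀` and `y^{σ_t} = y + (1,0)` are kernel theorems):
* (M-2y) for EVERY transversal `φ` of `𝒜/[ϖ′]` a RATIONAL point `y″ ∈ E_{2p}(ℚ)` with `transfer y″ = 2y_{2p,φ}` and
  `y″ ∉ 2E_{2p}(ℚ) + E_{2p}(ℚ)_tor` (`Tian2014.CMPointData.exists_transfer_eq_two_nsmul_yPoint_not_two_smul_add_torsion_prime_seven_mod_eight`);
* rank `E_{2p}(ℚ) = 1` (`≤ 1` = «`S̄ = ℤ/2`» on the Cor. 5.15 family `2p₇`, p528474); `2p` congruent; `Ш(E_{2p})[2^∞] = 0`;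
  `y″` has ODD INDEX against every generator of `E_{2p}(ℚ)/tor`;
* **Tian Prop. 4.6, EVEN TWIST, for ALL primes `p ≡ 3 (mod 4)`** from one binder (`…_three_mod_four_of_printed`): rank
  `E_{2p}(ℚ) = 1` and `2p` congruent — Monsky's Cor. 5.15 (1) «`2p₃`, `2p₇`» for Tian's points.
In the tree `2p₇` was so far reached through «`Σ₂′` odd» and DOOR B6 (relative to {`U⁺`, GZK}); this is a second,
Gross–Zagier-free proof of rank one there. Nothing is asserted unconditionally beyond the tree's own descent theorems.
[cite: Tian2014, Prop. 4.6 (arXiv:1210.8231 p0023 L15–L22) and its proof (p0024 L6–L30), §4.2 (p0022 L47–L70)]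
[cite: Monsky1990MockHeegner, Lemma 4.8 and Thm. 4.9 (p. 58), Cor. 5.15 (1) (p. 66), Remark (2) (p. 67)]
[cite: SilvermanAEC2009, Thm. X.4.2, Thm. VIII.6.7] [cite: TopYui2008Congruent, Prop. 3.3 (i) ⟺ (iv)]
-/

noncomputable section

open scoped Classical NumberTheorySymbols

open WeierstrassCurve NumberField Literature.NumberTheory.EllipticCurves
  Literature.NumberTheory.EllipticCurves.Rank1Residual
  Literature.NumberTheory.EllipticCurves.Rank1Residual.Typed
  Literature.NumberTheory.EllipticCurves.Monsky1990
  Literature.NumberTheory.EllipticCurves.TianYuanZhang2017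

set_option autoImplicit false

namespace Summit.BirchSwinnertonDyer.Rank1Residual.P2

open Conjectures Literature.NumberTheory.EllipticCurves.Tian2014

/-! ## §1 The family `2p₇` is a Cor. 5.15 family -/

/-- **`2p` with `p ≡ 7 (8)` prime is Monsky's family `2p₇` of Cor. 5.15 (1)**.
[cite: Monsky1990MockHeegner, Cor. 5.15 (1) (p. 66)] -/
theorem isCor515Family_two_mul_seven_mod_eight {p : ℕ} (hp : p.Prime) (hp8 : p % 8 = 7) :
    IsCor515Family (2 * p) :=
  Or.inr (Or.inl ⟨p, hp, Or.inr hp8, rfl⟩)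

/-! ## §2 Rank one, congruent, `Ш[2^∞] = 0` and the odd index on `2p₇` from the printed system binder -/

/-- **Rank `E_{2p}(ℚ) = 1` for every prime `p ≡ 7 (mod 8)` from the printed system binder alone** (Tian Prop. 4.6 =
Monsky Thm. 4.9 transplanted: `2y_{2p}` is the transfer of a rational point `y″ ∉ 2E + tor`, so `rank ≥ 1`; `rank ≤ 1`
is the tree's exact count `#Sel₂(E_{2p}) = 8` on the Cor. 5.15 family `2p₇`). No Gross–Zagier input.
[cite: Tian2014, Prop. 4.6 (p0023 L15–L22)] [cite: Monsky1990MockHeegner, Thm. 4.9 (p. 58), Cor. 5.15 (1) (p. 66)]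
[cite: SilvermanAEC2009, Thm. X.4.2] -/
theorem mordellWeilRank_eq_one_two_mul_seven_mod_eight_of_printed
    (hSk₇ : ∀ p : ℕ, p.Prime → p % 8 = 7 →
      ∃ D : CMPointData p, D.Printed ∧ (∀ s : D.H, s ^ 2 = 2 → D.tau s = s) ∧
        ∀ t : ClassGroup (𝓞 (GenusField (2 * p))), ¬ IsSquare t → ∀ s : D.H, s ^ 2 = 2 → D.art t s = -s) :
    ∀ p : ℕ, p.Prime → p % 8 = 7 → (congruentNumberCurve (2 * p)).mordellWeilRank = 1 := by
  intro p hp hp8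
  have hN : IsCor515Family (2 * p) := isCor515Family_two_mul_seven_mod_eight hp hp8
  haveI := isElliptic_congruentNumberCurve hN.ne_zero
  obtain ⟨D, hP, hτ2, hgen⟩ := hSk₇ p hp hp8
  obtain ⟨⟨φ, hφ⟩, hall⟩ :=
    D.exists_transfer_eq_two_nsmul_yPoint_not_two_smul_add_torsion_prime_seven_mod_eight hp hp8 hP hτ2 hgen
  obtain ⟨y'', -, hnot⟩ := hall φ hφ
  exact le_antisymm (mordellWeilRank_le_one_of_isCor515Family hN)
    (Nat.one_le_iff_ne_zero.mpr (mordellWeilRank_ne_zero_of_not_two_smul_add_torsion hN.ne_zero y'' hnot))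

/-- **`2p` is a congruent number for every prime `p ≡ 7 (mod 8)` from the printed system binder alone** (Cor. 5.15 (1)
«`2p₇`»). [cite: Tian2014, Prop. 4.6 (p0023 L20–L22)] [cite: Monsky1990MockHeegner, Cor. 5.15 (1) (p. 66)]
[cite: TopYui2008Congruent, Prop. 3.3 (i) ⟺ (iv)] -/
theorem isCongruentNumber_two_mul_seven_mod_eight_of_printed
    (hSk₇ : ∀ p : ℕ, p.Prime → p % 8 = 7 →
      ∃ D : CMPointData p, D.Printed ∧ (∀ s : D.H, s ^ 2 = 2 → D.tau s = s) ∧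
        ∀ t : ClassGroup (𝓞 (GenusField (2 * p))), ¬ IsSquare t → ∀ s : D.H, s ^ 2 = 2 → D.art t s = -s) :
    ∀ p : ℕ, p.Prime → p % 8 = 7 → IsCongruentNumber (2 * p) :=
  fun p hp hp8 =>
    (Wiles2000.mordellWeilRank_ne_zero_iff_isCongruentNumber (by have := hp.pos; omega)).mp
      (by rw [mordellWeilRank_eq_one_two_mul_seven_mod_eight_of_printed hSk₇ p hp hp8]; exact one_ne_zero)

/-- **`Ш(E_{2p})[2^∞] = 0` for every prime `p ≡ 7 (mod 8)` from the printed system binder alone** (rank one and the exact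
count `#Sel₂(E_{2p}) = 8`). [cite: Monsky1990MockHeegner, Remark (2) (p. 67)] [cite: SilvermanAEC2009, Thm. X.4.2] -/
theorem primaryComponent_sha_two_eq_bot_two_mul_seven_mod_eight_of_printed
    (hSk₇ : ∀ p : ℕ, p.Prime → p % 8 = 7 →
      ∃ D : CMPointData p, D.Printed ∧ (∀ s : D.H, s ^ 2 = 2 → D.tau s = s) ∧
        ∀ t : ClassGroup (𝓞 (GenusField (2 * p))), ¬ IsSquare t → ∀ s : D.H, s ^ 2 = 2 → D.art t s = -s) :
    ∀ p : ℕ, (hp : p.Prime) → p % 8 = 7 →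
      haveI := isElliptic_congruentNumberCurve (n := 2 * p) (Nat.mul_ne_zero two_ne_zero hp.ne_zero)
      AddCommGroup.primaryComponent (congruentNumberCurve (2 * p)).sha 2 = ⊥ := by
  intro p hp hp8
  have hN : IsCor515Family (2 * p) := isCor515Family_two_mul_seven_mod_eight hp hp8
  have h := (isCongruentNumber_iff_primaryComponent_sha_two_eq_bot_of_isCor515Family hN).mp
    (isCongruentNumber_two_mul_seven_mod_eight_of_printed hSk₇ p hp hp8)
  convert h

/-- **MONSKY'S THEOREM 4.9 (EVEN TWIST) FOR TIAN'S POINT `2y_{2p}`, `p ≡ 7 (mod 8)`, from the printed system binder alone**: for every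
such `p` and printed system `D` there is a transversal `φ` of `𝒜/[ϖ′]`, and for EVERY transversal a rational point
`y″ ∈ E_{2p}(ℚ)` with `transfer y″ = 2y_{2p,φ}`, of INFINITE ORDER and ODD INDEX against every generator of
`E_{2p}(ℚ)/tor`. No `L`-function, no Gross–Zagier display, no `2`-Selmer display.
[cite: Tian2014, Prop. 4.6 (p0023 L15–L22)] [cite: Monsky1990MockHeegner, Thm. 4.9 (p. 58)] -/
theorem monskyOddIndex_two_mul_seven_mod_eight_of_printed
    (hSk₇ : ∀ p : ℕ, p.Prime → p % 8 = 7 →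
      ∃ D : CMPointData p, D.Printed ∧ (∀ s : D.H, s ^ 2 = 2 → D.tau s = s) ∧
        ∀ t : ClassGroup (𝓞 (GenusField (2 * p))), ¬ IsSquare t → ∀ s : D.H, s ^ 2 = 2 → D.art t s = -s) :
    ∀ p : ℕ, (hp : p.Prime) → p % 8 = 7 →
      ∃ D : CMPointData p, D.Printed ∧ (∀ s : D.H, s ^ 2 = 2 → D.tau s = s) ∧
        (∃ φ, D.IsRepsModPiPrime φ) ∧
        ∀ φ : Finset (ClassGroup (𝓞 (GenusField (2 * p)))), D.IsRepsModPiPrime φ →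
          ∃ y'' : (congruentNumberCurve (2 * p)).toAffine.Point,
            D.transfer hp.ne_zero y'' = (2 : ℕ) • D.yPoint φ ∧ ¬ IsOfFinAddOrder y'' ∧
            (∀ g : (congruentNumberCurve (2 * p)).toAffine.Point, GeneratesFreePartRat (2 * p) g →
              ∃ m : ℤ, Odd m ∧ IsOfFinAddOrder (y'' - m • g)) := by
  intro p hp hp8
  obtain ⟨D, hP, hτ2, hgen⟩ := hSk₇ p hp hp8
  obtain ⟨hex, hall⟩ :=
    D.exists_transfer_eq_two_nsmul_yPoint_not_two_smul_add_torsion_prime_seven_mod_eight hp hp8 hP hτ2 hgen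
  refine ⟨D, hP, hτ2, hex, fun φ hφ => ?_⟩
  obtain ⟨y'', hy'', hnot⟩ := hall φ hφ
  exact ⟨y'', hy'', not_isOfFinAddOrder_of_not_two_smul_add_torsion y'' hnot,
    fun g hg => exists_odd_isOfFinAddOrder_sub_zsmul_of_not_two_smul_add_torsion y'' hnot g hg⟩

/-! ## §3 Tian Prop. 4.6, even twist, for every prime `p ≡ 3 (mod 4)` from ONE binder -/

/-- **Tian Prop. 4.6 (even twist `m = 2p₀`) for EVERY prime `p₀ ≡ 3 (mod 4)` from one printed system binder** — Monsky's
Cor. 5.15 (1) «`2p₃`, `2p₇`» for Tian's points: rank `E_{2p}(ℚ) = 1` and `2p` is a congruent number. The binder carries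
both printed sentences; the `p ≡ 3 (8)` half uses only the first (`…ThreeModEight…`), the `p ≡ 7 (8)` half both.
[cite: Tian2014, Prop. 4.6 (p0023 L15–L22)] [cite: Monsky1990MockHeegner, Thm. 4.6 (p. 57), Thm. 4.9 (p. 58), Cor. 5.15 (1) (p. 66)] -/
theorem mordellWeilRank_eq_one_and_isCongruentNumber_two_mul_three_mod_four_of_printed
    (hSk : ∀ p : ℕ, p.Prime → p % 4 = 3 →
      ∃ D : CMPointData p, D.Printed ∧ (∀ s : D.H, s ^ 2 = 2 → D.tau s = s) ∧
        ∀ t : ClassGroup (𝓞 (GenusField (2 * p))), ¬ IsSquare t → ∀ s : D.H, s ^ 2 = 2 → D.art t s = -s) :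
    ∀ p : ℕ, p.Prime → p % 4 = 3 →
      (congruentNumberCurve (2 * p)).mordellWeilRank = 1 ∧ IsCongruentNumber (2 * p) := by
  intro p hp hp4
  have hSk₁ : ∀ q : ℕ, q.Prime → q % 8 = 3 →
      ∃ D : CMPointData q, D.Printed ∧ ∀ s : D.H, s ^ 2 = 2 → D.tau s = s := fun q hq hq8 => by
    obtain ⟨D, hP, hτ2, -⟩ := hSk q hq (by omega)
    exact ⟨D, hP, hτ2⟩
  have hSk₇ : ∀ q : ℕ, q.Prime → q % 8 = 7 →
      ∃ D : CMPointData q, D.Printed ∧ (∀ s : D.H, s ^ 2 = 2 → D.tau s = s) ∧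
        ∀ t : ClassGroup (𝓞 (GenusField (2 * q))), ¬ IsSquare t → ∀ s : D.H, s ^ 2 = 2 → D.art t s = -s :=
    fun q hq hq8 => hSk q hq (by omega)
  rcases (by omega : p % 8 = 3 ∨ p % 8 = 7) with h | h
  · exact ⟨mordellWeilRank_eq_one_two_mul_three_mod_eight_of_printed hSk₁ p hp h,
      isCongruentNumber_two_mul_three_mod_eight_of_printed hSk₁ p hp h⟩
  · exact ⟨mordellWeilRank_eq_one_two_mul_seven_mod_eight_of_printed hSk₇ p hp h,
      isCongruentNumber_two_mul_seven_mod_eight_of_printed hSk₇ p hp h⟩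

end Summit.BirchSwinnertonDyer.Rank1Residual.P2

end
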